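import Summits.ResolutionOfSingularities.ResolutionOfSingularities.Theorems.ConeExit.Negative.Mirror
import Summits.ResolutionOfSingularities.ResolutionOfSingularities.Theorems.WildConesConeExitFaceDictionary

/-!
# Step dictionary for `NoPeriodicIsolatedAtom` / line `ridge_rank` — auxiliary file 2:
# one step of the point-blow-up calculus at a `u_i`-free exponent

Crux stmt-ResolutionOfSingularities-16344, stub `stub_stepDict`. Over the exact mirror
`Theorems/ConeExit/Negative/Mirror.lean` of the crux's coefficient calculus
(`clean / bl / ord / dv / tr / step`) we unfold ONE step `c ↦ step p i τ c` of a state of multiplicity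
`p` (so the step divides by `u_i ^ p` exactly: `faceDict_ord_ge` of the landed chart dictionary
`WildConesConeExitFaceDictionary.lean`, and `step_eq_of_le_ord`) at an exponent `B` with `B i = 0`:

* `dv_bl_apply`, `tr_apply`: the coefficient of the successor at `B` is the finite sum
  `∑_D clean c (A(B+D)) ∏_{j ≠ i} C(B_j + D_j, B_j) τ_j ^ D_j` over the window `D_i = 0`,
  `∑_{j ≠ i} (B_j + D_j) ≤ p`, with `A(B + D) = (B + D)` corrected at `i` to total degree `p`;
* `stepDict_a`: with no cleaned degree-`p` monomial, all these coefficients vanish;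
* `stepDict_b`: at `|B| = p` only `D = 0` survives, so the `u_i`-free degree-`p` coefficients are
  unchanged by the step;
* `tr_dv_bl_eq_sum_degree` (registered export `stepDict_tr_window`): the same sum re-indexed by
  the degree-`p` exponents `A` (`D_j = A_j - B_j`), the form matching the homogeneous Taylor formula.
-/

noncomputable section

-- single-problem summit: the doubled namespace component is forced by the tree layout
set_option linter.dupNamespace false

namespace Summit.ResolutionOfSingularities.ResolutionOfSingularities.Theorems.NoPeriodicIsolatedAtom.RidgeRank.StepDict

open Summit.ResolutionOfSingularities.ResolutionOfSingularities.Theorems.ConeExit.Negative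
open Summit.ResolutionOfSingularities.ResolutionOfSingularities.Theorems.WildConesConeExit (faceDict_ord_ge)
open scoped BigOperators Classical

variable {n : ℕ} {κ : Type} [Field κ]

/-! ## Small sums over `Fin n` with one coordinate singled out -/

/-- `∑_{j ≠ i}` ignores an update at `i`. [folklore] -/
theorem sum_erase_update (i : Fin n) (X : Fin n → ℕ) (v : ℕ) :
    Finset.sum (Finset.univ.erase i) (fun j => Function.update X i v j) =
      Finset.sum (Finset.univ.erase i) (fun j => X j) :=
  Finset.sum_congr rfl (fun j hj => by rw [Function.update_of_ne (Finset.ne_of_mem_erase hj)])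

/-- Total degree of an exponent updated at `i`. [folklore] -/
theorem sum_univ_update (i : Fin n) (X : Fin n → ℕ) (v : ℕ) :
    Finset.sum Finset.univ (fun j => Function.update X i v j) =
      v + Finset.sum (Finset.univ.erase i) (fun j => X j) := by
  rw [← Finset.add_sum_erase _ _ (Finset.mem_univ i), Function.update_self, sum_erase_update]

/-- Total degree `= X i + ∑_{j ≠ i} X j`. [folklore] -/
theorem sum_univ_eq_add_sum_erase (i : Fin n) (X : Fin n → ℕ) :
    Finset.sum Finset.univ (fun j => X j) = X i + Finset.sum (Finset.univ.erase i) (fun j => X j) :=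
  (Finset.add_sum_erase _ _ (Finset.mem_univ i)).symm

/-! ## Unfolding the mirrored operators -/

/-- `clean` pointwise. [folklore] -/
theorem clean_apply (p : ℕ) (c : (Fin n → ℕ) → κ) (A : Fin n → ℕ) :
    clean p c A = if ∀ j, p ∣ A j then 0 else c A := by
  unfold clean
  split_ifs <;> rfl

/-- From a state of cleaned order `≥ p` the step divides by `u_i ^ p` exactly. [folklore] -/
theorem step_eq_of_le_ord (p : ℕ) (c : (Fin n → ℕ) → κ) (i : Fin n) (τ : Fin n → κ)
    (h : p ≤ ord (clean p c)) :
    step p i τ c = clean p (tr i τ p (dv i p (bl i (clean p c)))) := by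
  unfold step
  rw [if_pos h]

/-- The blown-up-and-divided coefficient function, pointwise. [folklore] -/
theorem dv_bl_apply (i : Fin n) (s : ℕ) (c' : (Fin n → ℕ) → κ) (X : Fin n → ℕ) :
    dv i s (bl i c') X =
      if Finset.sum (Finset.univ.erase i) (fun j => X j) ≤ X i + s then
        c' (Function.update X i (X i + s - Finset.sum (Finset.univ.erase i) (fun j => X j)))
      else 0 := by
  unfold dv bl
  simp only [Function.update_self, Function.update_idem, sum_erase_update]

/-- The translated coefficient function, pointwise. [folklore] -/
theorem tr_apply (i : Fin n) (τ : Fin n → κ) (s : ℕ) (c' : (Fin n → ℕ) → κ) (B : Fin n → ℕ) :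
    tr i τ s c' B = Finset.sum (Fintype.piFinset (fun _ : Fin n => Finset.range (B i + s + 1)))
      (fun D => if D i = 0 then c' (B + D) * Finset.prod (Finset.univ.erase i)
        (fun j => ((Nat.choose (B j + D j) (B j) : ℕ) : κ) * τ j ^ (D j)) else 0) := by
  unfold tr
  exact Finset.sum_congr rfl (fun D _ => by split_ifs <;> rfl)

/-! ## (a) and (b) of the step dictionary -/

/-- **Step dictionary (a).** From a state of multiplicity `p` with NO cleaned monomial of degree
exactly `p`, every coefficient of the successor at an exponent `B` with `B i = 0` vanishes. [folklore] -/
theorem stepDict_a (p : ℕ) (c : (Fin n → ℕ) → κ) (i : Fin n) (τ : Fin n → κ)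
    (hmult : (∃ A, clean p c A ≠ 0) ∧ ∀ A, clean p c A ≠ 0 → p ≤ Finset.sum Finset.univ (fun j => A j))
    (hno : ∀ A, clean p c A ≠ 0 → Finset.sum Finset.univ (fun j => A j) ≠ p)
    (B : Fin n → ℕ) (hB : B i = 0) : clean p (step p i τ c) B = 0 := by
  rw [step_eq_of_le_ord p c i τ (faceDict_ord_ge p c hmult), clean_apply]
  by_cases hdiv : ∀ j, p ∣ B j
  · rw [if_pos hdiv]
  rw [if_neg hdiv, clean_apply, if_neg hdiv, tr_apply]
  refine Finset.sum_eq_zero (fun D _ => ?_)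
  by_cases hDi : D i = 0
  · rw [if_pos hDi, dv_bl_apply]
    by_cases hg : Finset.sum (Finset.univ.erase i) (fun j => (B + D) j) ≤ (B + D) i + p
    · rw [if_pos hg]
      have hBD : (B + D) i = 0 := by rw [Pi.add_apply, hB, hDi]
      have hdeg : Finset.sum Finset.univ (fun j => Function.update (B + D) i
          ((B + D) i + p - Finset.sum (Finset.univ.erase i) (fun j => (B + D) j)) j) = p := by
        rw [sum_univ_update]; omega
      by_contra hne
      exact hno _ (fun h => hne (by rw [h, zero_mul])) hdeg
    · rw [if_neg hg, zero_mul]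
  · rw [if_neg hDi]

/-- **Step dictionary (b).** From a state of multiplicity `p`, the `u_i`-free degree-`p`
coefficients are unchanged by the step (only `D = 0` passes the blow-up guard). [folklore] -/
theorem stepDict_b (p : ℕ) (c : (Fin n → ℕ) → κ) (i : Fin n) (τ : Fin n → κ)
    (hmult : (∃ A, clean p c A ≠ 0) ∧ ∀ A, clean p c A ≠ 0 → p ≤ Finset.sum Finset.univ (fun j => A j))
    (A : Fin n → ℕ) (hAi : A i = 0) (hdeg : Finset.sum Finset.univ (fun j => A j) = p) :
    clean p (step p i τ c) A = clean p c A := by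
  rw [step_eq_of_le_ord p c i τ (faceDict_ord_ge p c hmult)]
  by_cases hdiv : ∀ j, p ∣ A j
  · rw [clean_apply, if_pos hdiv, clean_apply, if_pos hdiv]
  rw [clean_apply, if_neg hdiv, clean_apply, if_neg hdiv, tr_apply]
  have hA' : Finset.sum (Finset.univ.erase i) (fun j => A j) = p := by
    rw [sum_univ_eq_add_sum_erase i, hAi, zero_add] at hdeg; exact hdeg
  have hmem : (0 : Fin n → ℕ) ∈ Fintype.piFinset (fun _ : Fin n => Finset.range (A i + p + 1)) :=
    Fintype.mem_piFinset.mpr (fun _ => Finset.mem_range.mpr (Nat.succ_pos _))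
  rw [Finset.sum_eq_single_of_mem (0 : Fin n → ℕ) hmem]
  · have hg : Finset.sum (Finset.univ.erase i) (fun j => A j) ≤ A i + p := by rw [hA']; omega
    rw [if_pos (show (0 : Fin n → ℕ) i = 0 from rfl), add_zero, dv_bl_apply, if_pos hg]
    have hupd : Function.update A i (A i + p - Finset.sum (Finset.univ.erase i) (fun j => A j)) = A := by
      rw [hA', (by omega : A i + p - p = A i)]; exact Function.update_eq_self i A
    have hprod : Finset.prod (Finset.univ.erase i) (fun j => ((Nat.choose (A j + (0 : Fin n → ℕ) j) (A j) : ℕ) : κ) *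
        τ j ^ ((0 : Fin n → ℕ) j)) = 1 :=
      Finset.prod_eq_one (fun j _ => by simp)
    rw [hupd, hprod, mul_one, clean_apply, if_neg hdiv]
  · intro D _ hD0
    by_cases hDi : D i = 0
    · obtain ⟨j, hj⟩ : ∃ j, D j ≠ 0 := by
        by_contra hcon
        push Not at hcon
        exact hD0 (funext hcon)
      have hji : j ≠ i := fun h => hj (h ▸ hDi)
      have h1 : Finset.sum (Finset.univ.erase i) (fun k => (A + D) k) =
          Finset.sum (Finset.univ.erase i) (fun k => A k) +
            Finset.sum (Finset.univ.erase i) (fun k => D k) := by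
        simp only [Pi.add_apply]; exact Finset.sum_add_distrib
      have h2 : D j ≤ Finset.sum (Finset.univ.erase i) (fun k => D k) :=
        Finset.single_le_sum (f := fun k => D k) (fun k _ => Nat.zero_le _)
          (Finset.mem_erase.mpr ⟨hji, Finset.mem_univ j⟩)
      have h3 : (A + D) i = 0 := by rw [Pi.add_apply, hAi, hDi]
      have hng : ¬ Finset.sum (Finset.univ.erase i) (fun k => (A + D) k) ≤ (A + D) i + p := by
        rw [h1, hA', h3]; omega
      rw [if_pos hDi, dv_bl_apply, if_neg hng, zero_mul]
    · rw [if_neg hDi]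

/-! ## Re-indexing the translated coefficient by degree-`p` exponents -/

/-- **The window sum re-indexed.** For `B` with `B i = 0`, the coefficient of
`tr i τ p (dv i p (bl i c'))` at `B` equals the sum over the exponents `A` of total degree `p`
(coordinates `≤ p`) of `c' A ∏_{j ≠ i} C(A_j, B_j) τ_j ^ (A_j - B_j)` — the bijection is
`D ↦ A = (B + D)` corrected at `i` to degree `p`, `A ↦ D = A - B` off `i`; exponents `A` with some
`A_j < B_j` contribute `0` through the binomial. [folklore] -/
theorem tr_dv_bl_eq_sum_degree (p : ℕ) (i : Fin n) (τ : Fin n → κ) (c' : (Fin n → ℕ) → κ)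
    (B : Fin n → ℕ) (hB : B i = 0) :
    tr i τ p (dv i p (bl i c')) B =
      Finset.sum ((Fintype.piFinset (fun _ : Fin n => Finset.range (p + 1))).filter
          (fun A => Finset.sum Finset.univ (fun j => A j) = p))
        (fun A => c' A * Finset.prod (Finset.univ.erase i)
          (fun j => ((Nat.choose (A j) (B j) : ℕ) : κ) * τ j ^ (A j - B j))) := by
  rw [tr_apply, hB, zero_add]
  -- the two index maps
  let φ : (Fin n → ℕ) → (Fin n → ℕ) := fun D =>
    Function.update (B + D) i (p - Finset.sum (Finset.univ.erase i) (fun j => (B + D) j))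
  let ψ : (Fin n → ℕ) → (Fin n → ℕ) := fun A => Function.update (A - B) i 0
  have hφ_ne : ∀ D j, j ≠ i → φ D j = B j + D j := fun D j hj => by
    simp only [φ, Function.update_of_ne hj, Pi.add_apply]
  have hφ_i : ∀ D, φ D i = p - Finset.sum (Finset.univ.erase i) (fun j => (B + D) j) := fun D => by
    simp only [φ, Function.update_self]
  have hψ_ne : ∀ A j, j ≠ i → ψ A j = A j - B j := fun A j hj => by
    simp only [ψ, Function.update_of_ne hj, Pi.sub_apply]
  have hψ_i : ∀ A, ψ A i = 0 := fun A => by simp only [ψ, Function.update_self]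
  -- Step 1: the live window
  have step1 : Finset.sum (Fintype.piFinset (fun _ : Fin n => Finset.range (p + 1)))
      (fun D => if D i = 0 then dv i p (bl i c') (B + D) * Finset.prod (Finset.univ.erase i)
        (fun j => ((Nat.choose (B j + D j) (B j) : ℕ) : κ) * τ j ^ (D j)) else 0) =
      Finset.sum ((Fintype.piFinset (fun _ : Fin n => Finset.range (p + 1))).filter
        (fun D => D i = 0 ∧ Finset.sum (Finset.univ.erase i) (fun j => (B + D) j) ≤ p))
      (fun D => c' (φ D) * Finset.prod (Finset.univ.erase i)
        (fun j => ((Nat.choose (B j + D j) (B j) : ℕ) : κ) * τ j ^ (D j))) := by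
    rw [Finset.sum_filter]
    refine Finset.sum_congr rfl (fun D _ => ?_)
    by_cases hDi : D i = 0
    · have hBD : (B + D) i = 0 := by rw [Pi.add_apply, hB, hDi]
      rw [if_pos hDi, dv_bl_apply, hBD, zero_add]
      by_cases hg : Finset.sum (Finset.univ.erase i) (fun j => (B + D) j) ≤ p
      · rw [if_pos hg, if_pos ⟨hDi, hg⟩]
      · rw [if_neg hg, if_neg (fun h => hg h.2), zero_mul]
    · rw [if_neg hDi, if_neg (fun h => hDi h.1)]
  -- Step 2: drop the exponents with a vanishing binomial
  have step2 : Finset.sum ((Fintype.piFinset (fun _ : Fin n => Finset.range (p + 1))).filter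
          (fun A => Finset.sum Finset.univ (fun j => A j) = p))
        (fun A => c' A * Finset.prod (Finset.univ.erase i)
          (fun j => ((Nat.choose (A j) (B j) : ℕ) : κ) * τ j ^ (A j - B j))) =
      Finset.sum (((Fintype.piFinset (fun _ : Fin n => Finset.range (p + 1))).filter
          (fun A => Finset.sum Finset.univ (fun j => A j) = p)).filter
          (fun A => ∀ j, j ≠ i → B j ≤ A j))
        (fun A => c' A * Finset.prod (Finset.univ.erase i)
          (fun j => ((Nat.choose (A j) (B j) : ℕ) : κ) * τ j ^ (A j - B j))) := by
    symm
    apply Finset.sum_filter_of_ne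
    intro A _ hne j hji
    by_contra hlt
    push Not at hlt
    apply hne
    apply mul_eq_zero_of_right
    apply Finset.prod_eq_zero (Finset.mem_erase.mpr ⟨hji, Finset.mem_univ j⟩)
    rw [Nat.choose_eq_zero_of_lt hlt, Nat.cast_zero, zero_mul]
  rw [step1, step2]
  -- Step 3: the bijection
  apply Finset.sum_nbij' φ ψ
  · intro D hD
    rw [Finset.mem_filter] at hD
    obtain ⟨hDm, hDi, hg⟩ := hD
    rw [Fintype.mem_piFinset] at hDm
    have hle : ∀ j, j ≠ i → B j + D j ≤ Finset.sum (Finset.univ.erase i) (fun j => (B + D) j) :=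
      fun j hj => Finset.single_le_sum (f := fun j => (B + D) j) (fun k _ => Nat.zero_le _)
        (Finset.mem_erase.mpr ⟨hj, Finset.mem_univ j⟩)
    rw [Finset.mem_filter, Finset.mem_filter, Fintype.mem_piFinset]
    refine ⟨⟨fun j => Finset.mem_range.mpr ?_, ?_⟩, fun j hj => ?_⟩
    · by_cases hj : j = i
      · rw [hj, hφ_i]; omega
      · rw [hφ_ne D j hj]; have := hle j hj; omega
    · show Finset.sum Finset.univ (fun j => φ D j) = p
      simp only [φ]
      rw [sum_univ_update]; omega
    · rw [hφ_ne D j hj]; omega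
  · intro A hA
    rw [Finset.mem_filter, Finset.mem_filter, Fintype.mem_piFinset] at hA
    obtain ⟨⟨hAm, hdeg⟩, hdom⟩ := hA
    have hsum : Finset.sum (Finset.univ.erase i) (fun j => (B + ψ A) j) =
        Finset.sum (Finset.univ.erase i) (fun j => A j) :=
      Finset.sum_congr rfl (fun j hj => by
        rw [Pi.add_apply, hψ_ne A j (Finset.ne_of_mem_erase hj)]
        have := hdom j (Finset.ne_of_mem_erase hj); omega)
    rw [Finset.mem_filter, Fintype.mem_piFinset]
    refine ⟨fun j => Finset.mem_range.mpr ?_, hψ_i A, ?_⟩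
    · by_cases hj : j = i
      · rw [hj, hψ_i]; omega
      · rw [hψ_ne A j hj]; have := Finset.mem_range.mp (hAm j); omega
    · rw [hsum, ← hdeg, sum_univ_eq_add_sum_erase i A]; omega
  · intro D hD
    rw [Finset.mem_filter] at hD
    obtain ⟨_, hDi, _⟩ := hD
    funext j
    by_cases hj : j = i
    · rw [hj, hψ_i, hDi]
    · rw [hψ_ne _ j hj, hφ_ne D j hj, Nat.add_sub_cancel_left]
  · intro A hA
    rw [Finset.mem_filter, Finset.mem_filter, Fintype.mem_piFinset] at hA
    obtain ⟨⟨_, hdeg⟩, hdom⟩ := hA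
    have hsum : Finset.sum (Finset.univ.erase i) (fun j => (B + ψ A) j) =
        Finset.sum (Finset.univ.erase i) (fun j => A j) :=
      Finset.sum_congr rfl (fun j hj => by
        rw [Pi.add_apply, hψ_ne A j (Finset.ne_of_mem_erase hj)]
        have := hdom j (Finset.ne_of_mem_erase hj); omega)
    funext j
    by_cases hj : j = i
    · rw [hj, hφ_i, hsum]
      rw [sum_univ_eq_add_sum_erase i A] at hdeg
      omega
    · rw [hφ_ne _ j hj, hψ_ne A j hj]
      have := hdom j hj; omega
  · intro D _
    congr 1
    refine Finset.prod_congr rfl (fun j hj => ?_)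
    rw [hφ_ne D j (Finset.ne_of_mem_erase hj), Nat.add_sub_cancel_left]

/-- **Registered export** (stub `stepDict_tr_window` of crux stmt-ResolutionOfSingularities-16344):
closed form of `tr_dv_bl_eq_sum_degree`. [folklore] -/
theorem stepDict_tr_window : ∀ {n : ℕ} {κ : Type} [Field κ] (p : ℕ) (i : Fin n) (τ : Fin n → κ) (c' : (Fin n → ℕ) → κ) (B : Fin n → ℕ), B i = 0 →
    tr i τ p (dv i p (bl i c')) B = Finset.sum ((Fintype.piFinset (fun _ : Fin n => Finset.range (p + 1))).filter (fun A => Finset.sum Finset.univ (fun j => A j) = p)) (fun A => c' A * Finset.prod (Finset.univ.erase i) (fun j => ((Nat.choose (A j) (B j) : ℕ) : κ) * τ j ^ (A j - B j))) :=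
  fun p i τ c' B hB => tr_dv_bl_eq_sum_degree p i τ c' B hB

end Summit.ResolutionOfSingularities.ResolutionOfSingularities.Theorems.NoPeriodicIsolatedAtom.RidgeRank.StepDict

end
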